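import Literature.Probability.Percolation.KozmaNitzanSeparatingTriple
import Literature.Probability.Percolation.KozmaNitzanHittable
import HarnessLib

/-!
# The REVERSE of the Y-split corollary hypothesis holds at every avoided set: the class of `Consts.crossM2_of_ySplit` is degenerate
# (PAPER-2 track (ii): constants of the CSH family; seat `prim-consts-2`, gen 25 — proof by the referee seat `prim-consts-3`, gens 114–116)

builds on p205010 (kernel theorem, internal audit signed; external expert review pending).  Support file (`--supports
stmt-CriticalPhenomena-4575`); referee reports `run/shared/lean/prim/consts/prim-consts-3/g114/REFEREE-g114.md` … `g116/REFEREE-g116.md`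
(scratch `g116/lean/ReverseHcondX_ref.lean`, landed here verbatim up to namespacing); memo `FROM-prim-consts-2-g24-CYLINDER-EVENTS.md` §0(4).
Theorems only (no definitions, no sorries, standard axioms); imports `Literature.*` only, so the statements are in the literal cell
language of `Consts.crossM2_of_ySplit` (…ConstsCrossMarkerYSplit.lean, p379150) without importing it.

CELLS (`μ = prodBernoulli w`, owner `s`, markers `y, z`, avoided set `X`, `D = {s ↮ X}`, `Z = {s~z}`, `Y = {s~y}`):
`a_X = μ(y ↮ {s}∪X∪{z}, s ↮ X∪{z})`, `b_X = μ(y~z, y ↮ {s}∪X, s ↮ X)`, `c = μ(D∩Z∩Y)`, `b = μ(D∩Zᶜ∩Y)`, `b_y′ = μ(D∩Z∩Yᶜ)`, `n = μ(D∩Zᶜ∩Yᶜ)`.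
The Y-split THEOREM A (`Consts.crossM2_ySplit`) gives `n·M₂(X)(F) ≥ n·M₂(X)(F_Y) + [b_X·b·n − a_X·(c·n − b·b_y′)]·∫_{D∩Zᶜ∩Yᶜ}F`, and its
corollary `Consts.crossM2_of_ySplit` assumed `hcond : a_X·(c·n − b·b_y′) ≤ b_X·b·n` to reduce the generic class to the pinned class.
* `Consts.YSplitReverse.reverse_hcond_X_strong` — **THEOREM: `b_X·b·n + b·b_X·b_y′ ≤ a_X·(c·n − b·b_y′)` for every `w, s, y, z, X`.**
* `Consts.YSplitReverse.reverse_hcond_X` — hence the REVERSE of `hcond` always holds: `b_X·b·n ≤ a_X·(c·n − b·b_y′)`;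
* `Consts.YSplitReverse.hcond_imp_degenerate` — and `hcond` forces `b·b_X·b_y′ = 0`: the corollary's class of placements is
  `{μ(s~y, s↮X∪{z}) = 0} ∪ {b_X = 0} ∪ {μ(s~z, s≁y, s↮X) = 0}` (at `X = ∅`: `s` a cut vertex between the markers, or no `y–z` connection off `s`),
  NOT the "≈ 20–30 % of placements" announced in memo g24 §0(4) (that count used a wrong sign convention; retired).
PROOF — two instances of the two-set BHK conditional association (`BHK2006_twoSetConditionalAssociation`, vdBHK Thm 2.1 at `q = 1`, sets form):
(HE) sources `S = {s,y}`, avoided `T = X`, `A = {z ∈ V(C_S)}`, `B = {s~y}` (both increasing in `C_S`): `(byE + b_X)·b ≤ c·a_X` with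
`byE := μ(s↮X, s≁y, s~z, y↮X)`; (P) `S = {s}`, `T = X∪{y}`, `A = {s~z}` (increasing in `C_S`), `B = {y~X}` (increasing in `C_T`, negative
correlation): `byr·(a_X + b_X) ≤ byE·r` with `byr := μ(s↮X, s≁y, s~z, y~X)`, `r := μ(s↮X∪{z}, s≁y, y~X)`; and the IDENTITY `n = a_X + b_X + r`,
`b_y′ = byE + byr`, `a_X(c n − b b_y′) − b_X b n = n·[c a_X − b(byE + b_X)] + b·[byE r − byr(a_X + b_X)] + b·b_X·b_y′`.
Exact census (referee g114–g116): 4 500/4 500 placements `|X| ≤ 3`.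
[cite: VandenbergHaggstromKahn2005, Thm. 2.1 (p. 10) at q = 1, Thm. 1.3 (p. 6)]
-/

noncomputable section

namespace Summit.CriticalPhenomena.PercolationContinuityZ3.Theorems

namespace Consts.YSplitReverse

open MeasureTheory Set Literature.Probability.LatticeModels Literature.Probability.Percolation
open Literature.Probability.Percolation.TripodExchange Literature.Probability.Percolation.TwoSetConditionalAssociation
open Literature.Probability.Percolation.KNSep
open scoped Classical

variable {V : Type*} [Fintype V]

/-- `μ(S) = μ(S ∩ A) + μ(S ∩ Aᶜ)`. [folklore] -/
theorem split_real (w : Sym2 V → unitInterval) (S A : Set (BondConfig V)) :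
    (prodBernoulli w).real S = (prodBernoulli w).real (S ∩ A) + (prodBernoulli w).real (S ∩ Aᶜ) := by
  rw [← Set.sdiff_eq]
  exact (measureReal_inter_add_sdiff (μ := prodBernoulli w) (s := S) (MeasurableSet.of_discrete : MeasurableSet A)).symm

/-- Four-cell form of a (denominator-free) positive association `μ(D∩A)μ(D∩B) ≤ μ(D)μ(D∩(A∩B))`. [folklore] -/
theorem cells_of_pa (w : Sym2 V → unitInterval) (D A B : Set (BondConfig V))
    (h : (prodBernoulli w).real (D ∩ A) * (prodBernoulli w).real (D ∩ B) ≤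
      (prodBernoulli w).real D * (prodBernoulli w).real (D ∩ (A ∩ B))) :
    (prodBernoulli w).real (D ∩ A ∩ Bᶜ) * (prodBernoulli w).real (D ∩ Aᶜ ∩ B) ≤
      (prodBernoulli w).real (D ∩ A ∩ B) * (prodBernoulli w).real (D ∩ Aᶜ ∩ Bᶜ) := by
  have h1 := split_real w (D ∩ A) B
  have h2 := split_real w (D ∩ B) A
  have h3 := split_real w D A
  have h4 := split_real w (D ∩ Aᶜ) B
  rw [show D ∩ B ∩ A = D ∩ A ∩ B by rw [inter_right_comm], show D ∩ B ∩ Aᶜ = D ∩ Aᶜ ∩ B by rw [inter_right_comm]] at h2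
  rw [← inter_assoc] at h
  rw [h3, h4, h1, h2] at h
  nlinarith [h]

/-- Four-cell form of a negative correlation `μ(D)μ(D∩(A∩B)) ≤ μ(D∩A)μ(D∩B)`. [folklore] -/
theorem cells_of_nc (w : Sym2 V → unitInterval) (D A B : Set (BondConfig V))
    (h : (prodBernoulli w).real D * (prodBernoulli w).real (D ∩ (A ∩ B)) ≤
      (prodBernoulli w).real (D ∩ A) * (prodBernoulli w).real (D ∩ B)) :
    (prodBernoulli w).real (D ∩ A ∩ B) * (prodBernoulli w).real (D ∩ Aᶜ ∩ Bᶜ) ≤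
      (prodBernoulli w).real (D ∩ A ∩ Bᶜ) * (prodBernoulli w).real (D ∩ Aᶜ ∩ B) := by
  have h1 := split_real w (D ∩ A) B
  have h2 := split_real w (D ∩ B) A
  have h3 := split_real w D A
  have h4 := split_real w (D ∩ Aᶜ) B
  rw [show D ∩ B ∩ A = D ∩ A ∩ B by rw [inter_right_comm], show D ∩ B ∩ Aᶜ = D ∩ Aᶜ ∩ B by rw [inter_right_comm]] at h2
  rw [← inter_assoc] at h
  rw [h3, h4, h1, h2] at h
  nlinarith [h]

/-- BHK (set form, both events increasing in `C_S`), four-cell form. [cite: VandenbergHaggstromKahn2005, Thm. 2.1 (p. 10)] -/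
theorem pa_cells (w : Sym2 V → unitInterval) (S T : Set V) (P₁ P₂ : Set (Sym2 V) → Prop)
    (hP₁ : ∀ ⦃C C' : Set (Sym2 V)⦄, C ⊆ C' → P₁ C → P₁ C')
    (hP₂ : ∀ ⦃C C' : Set (Sym2 V)⦄, C ⊆ C' → P₂ C → P₂ C') :
    (prodBernoulli w).real ({ω : BondConfig V | ∀ s ∈ S, ∀ t ∈ T, ¬ (openGraph ω).Reachable s t} ∩
          {ω | P₁ (⋃ s ∈ S, openEdgeCluster ω s)} ∩ {ω | P₂ (⋃ s ∈ S, openEdgeCluster ω s)}ᶜ) *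
        (prodBernoulli w).real ({ω : BondConfig V | ∀ s ∈ S, ∀ t ∈ T, ¬ (openGraph ω).Reachable s t} ∩
          {ω | P₁ (⋃ s ∈ S, openEdgeCluster ω s)}ᶜ ∩ {ω | P₂ (⋃ s ∈ S, openEdgeCluster ω s)}) ≤
      (prodBernoulli w).real ({ω : BondConfig V | ∀ s ∈ S, ∀ t ∈ T, ¬ (openGraph ω).Reachable s t} ∩
          {ω | P₁ (⋃ s ∈ S, openEdgeCluster ω s)} ∩ {ω | P₂ (⋃ s ∈ S, openEdgeCluster ω s)}) *
        (prodBernoulli w).real ({ω : BondConfig V | ∀ s ∈ S, ∀ t ∈ T, ¬ (openGraph ω).Reachable s t} ∩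
          {ω | P₁ (⋃ s ∈ S, openEdgeCluster ω s)}ᶜ ∩ {ω | P₂ (⋃ s ∈ S, openEdgeCluster ω s)}ᶜ) := by
  have key := BHK2006_twoSetConditionalAssociation w S T
    (fun C _ => if P₁ C then (1 : ℝ) else 0) (fun C _ => if P₂ C then (1 : ℝ) else 0)
    (fun _ => predIndicator_monotone hP₁) (fun _ => antitone_const)
    (fun _ => predIndicator_monotone hP₂) (fun _ => antitone_const)
  simp only [predIndicator_eq_indicator (fun ω => P₁ (⋃ s ∈ S, openEdgeCluster ω s)),
    predIndicator_eq_indicator (fun ω => P₂ (⋃ s ∈ S, openEdgeCluster ω s))] at key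
  simp only [setIntegral_indicator_one_eq, setIntegral_indicator_mul_indicator_eq] at key
  exact cells_of_pa w _ _ _ key

/-- BHK (set form, `A` increasing in `C_S`, `B` increasing in `C_T`: negative correlation), four-cell form. [cite: VandenbergHaggstromKahn2005, Thm. 2.1 (p. 10)] -/
theorem nc_cells (w : Sym2 V → unitInterval) (S T : Set V) (P Q : Set (Sym2 V) → Prop)
    (hP : ∀ ⦃C C' : Set (Sym2 V)⦄, C ⊆ C' → P C → P C')
    (hQ : ∀ ⦃C C' : Set (Sym2 V)⦄, C ⊆ C' → Q C → Q C') :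
    (prodBernoulli w).real ({ω : BondConfig V | ∀ s ∈ S, ∀ t ∈ T, ¬ (openGraph ω).Reachable s t} ∩
          {ω | P (⋃ s ∈ S, openEdgeCluster ω s)} ∩ {ω | Q (⋃ t ∈ T, openEdgeCluster ω t)}) *
        (prodBernoulli w).real ({ω : BondConfig V | ∀ s ∈ S, ∀ t ∈ T, ¬ (openGraph ω).Reachable s t} ∩
          {ω | P (⋃ s ∈ S, openEdgeCluster ω s)}ᶜ ∩ {ω | Q (⋃ t ∈ T, openEdgeCluster ω t)}ᶜ) ≤
      (prodBernoulli w).real ({ω : BondConfig V | ∀ s ∈ S, ∀ t ∈ T, ¬ (openGraph ω).Reachable s t} ∩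
          {ω | P (⋃ s ∈ S, openEdgeCluster ω s)} ∩ {ω | Q (⋃ t ∈ T, openEdgeCluster ω t)}ᶜ) *
        (prodBernoulli w).real ({ω : BondConfig V | ∀ s ∈ S, ∀ t ∈ T, ¬ (openGraph ω).Reachable s t} ∩
          {ω | P (⋃ s ∈ S, openEdgeCluster ω s)}ᶜ ∩ {ω | Q (⋃ t ∈ T, openEdgeCluster ω t)}) := by
  have key := BHK2006_twoSetConditionalAssociation.negCorrelation w S T
    (fun C => if P C then (1 : ℝ) else 0) (fun C => if Q C then (1 : ℝ) else 0)
    (predIndicator_monotone hP) (predIndicator_monotone hQ)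
  simp only [predIndicator_eq_indicator (fun ω => P (⋃ s ∈ S, openEdgeCluster ω s)),
    predIndicator_eq_indicator (fun ω => Q (⋃ t ∈ T, openEdgeCluster ω t))] at key
  simp only [setIntegral_indicator_one_eq, setIntegral_indicator_mul_indicator_eq] at key
  exact cells_of_nc w _ _ _ key

/-- **THE REVERSE INEQUALITY AT GENERAL `X`, with its remainder**, in the cell language of `Consts.crossM2_of_ySplit`:
`b_X·b·n + b·b_X·b_y′ ≤ a_X·(c·n − b·b_y′)`. [cite: VandenbergHaggstromKahn2005, Thm. 2.1 (p. 10)] -/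
theorem reverse_hcond_X_strong (w : Sym2 V → unitInterval) (s y z : V) (X : Set V) :
    (prodBernoulli w).real ({ω : BondConfig V | ∀ x ∈ insert s X, ¬ (openGraph ω).Reachable y x} ∩
          {ω | ∀ x ∈ X, ¬ (openGraph ω).Reachable s x} ∩ openConn y z) *
        (prodBernoulli w).real ({ω : BondConfig V | ∀ x ∈ insert z X, ¬ (openGraph ω).Reachable s x} ∩ openConn s y) *
      (prodBernoulli w).real {ω : BondConfig V | (∀ x ∈ insert z X, ¬ (openGraph ω).Reachable s x) ∧ ¬ (openGraph ω).Reachable s y} +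
      (prodBernoulli w).real ({ω : BondConfig V | ∀ x ∈ insert z X, ¬ (openGraph ω).Reachable s x} ∩ openConn s y) *
        (prodBernoulli w).real ({ω : BondConfig V | ∀ x ∈ insert s X, ¬ (openGraph ω).Reachable y x} ∩
          {ω | ∀ x ∈ X, ¬ (openGraph ω).Reachable s x} ∩ openConn y z) *
        (prodBernoulli w).real {ω : BondConfig V | (∀ x ∈ X, ¬ (openGraph ω).Reachable s x) ∧ (openGraph ω).Reachable s z ∧
              ¬ (openGraph ω).Reachable s y} ≤
    (prodBernoulli w).real ({ω : BondConfig V | ∀ x ∈ insert s (insert z X), ¬ (openGraph ω).Reachable y x} ∩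
          {ω | ∀ x ∈ insert z X, ¬ (openGraph ω).Reachable s x}) *
        ((prodBernoulli w).real ({ω : BondConfig V | ∀ x ∈ X, ¬ (openGraph ω).Reachable s x} ∩ openConn s z ∩ openConn s y) *
            (prodBernoulli w).real {ω : BondConfig V | (∀ x ∈ insert z X, ¬ (openGraph ω).Reachable s x) ∧ ¬ (openGraph ω).Reachable s y} -
          (prodBernoulli w).real ({ω : BondConfig V | ∀ x ∈ insert z X, ¬ (openGraph ω).Reachable s x} ∩ openConn s y) *
            (prodBernoulli w).real {ω : BondConfig V | (∀ x ∈ X, ¬ (openGraph ω).Reachable s x) ∧ (openGraph ω).Reachable s z ∧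
              ¬ (openGraph ω).Reachable s y}) := by
  have mem : ∀ (η : BondConfig V) (u v : V), η ∈ (openConn u v : Set (BondConfig V)) ↔
      (openGraph η).Reachable u v := fun _ _ _ => Iff.rfl
  -- the six tree cells
  set aX := (prodBernoulli w).real ({ω : BondConfig V | ∀ x ∈ insert s (insert z X), ¬ (openGraph ω).Reachable y x} ∩
    {ω | ∀ x ∈ insert z X, ¬ (openGraph ω).Reachable s x}) with haX
  set bX := (prodBernoulli w).real ({ω : BondConfig V | ∀ x ∈ insert s X, ¬ (openGraph ω).Reachable y x} ∩
    {ω | ∀ x ∈ X, ¬ (openGraph ω).Reachable s x} ∩ openConn y z) with hbX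
  set c := (prodBernoulli w).real ({ω : BondConfig V | ∀ x ∈ X, ¬ (openGraph ω).Reachable s x} ∩ openConn s z ∩ openConn s y) with hc
  set b := (prodBernoulli w).real ({ω : BondConfig V | ∀ x ∈ insert z X, ¬ (openGraph ω).Reachable s x} ∩ openConn s y) with hb
  set nn := (prodBernoulli w).real {ω : BondConfig V | (∀ x ∈ insert z X, ¬ (openGraph ω).Reachable s x) ∧ ¬ (openGraph ω).Reachable s y} with hn
  set byp := (prodBernoulli w).real {ω : BondConfig V | (∀ x ∈ X, ¬ (openGraph ω).Reachable s x) ∧ (openGraph ω).Reachable s z ∧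
    ¬ (openGraph ω).Reachable s y} with hbyp
  ---------------------------------------------------------------- (P): S = {s}, T = X ∪ {y}
  set D' : Set (BondConfig V) := {ω | ∀ s' ∈ ({s} : Set V), ∀ t ∈ insert y X, ¬ (openGraph ω).Reachable s' t} with hD'
  set B : Set (BondConfig V) := {ω | ∃ x ∈ X, (openGraph ω).Reachable y x} with hB
  have hP := nc_cells w ({s} : Set V) (insert y X)
    (fun C => z ∈ ({s} : Set V) ∨ ∃ e ∈ C, z ∈ e)
    (fun C => ∃ x ∈ X, (openGraph C).Reachable y x)
    (fun C C' h => Or.imp_right fun ⟨e, he, hze⟩ => ⟨e, h he, hze⟩)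
    (fun C C' h ⟨x, hx, hyx⟩ => ⟨x, hx, hyx.mono (openGraph_mono h)⟩)
  have eA : {ω : BondConfig V | z ∈ ({s} : Set V) ∨ ∃ e ∈ ⋃ s' ∈ ({s} : Set V), openEdgeCluster ω s', z ∈ e} = openConn s z := by
    rw [setOf_mem_or_exists_mem_biUnion_openEdgeCluster, biUnion_singleton]
  have eB : {ω : BondConfig V | ∃ x ∈ X, (openGraph (⋃ t ∈ insert y X, openEdgeCluster ω t)).Reachable y x} = B := by
    ext ω
    simp only [hB, mem_setOf_eq]
    exact exists_congr fun x => and_congr_right fun _ =>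
      (reachable_iff_cluster ω (insert y X) (mem_insert y X) x).symm
  simp only [eA, eB, ← hD'] at hP
  -- hP : μ(D'∩Z∩B) μ(D'∩Zᶜ∩Bᶜ) ≤ μ(D'∩Z∩Bᶜ) μ(D'∩Zᶜ∩B)
  ---------------------------------------------------------------- (HE): S = {s, y}, T = X
  set DE : Set (BondConfig V) := {ω | ∀ s' ∈ ({s, y} : Set V), ∀ t ∈ X, ¬ (openGraph ω).Reachable s' t} with hDE
  have hHE := pa_cells w ({s, y} : Set V) X
    (fun C => z ∈ ({s, y} : Set V) ∨ ∃ e ∈ C, z ∈ e)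
    (fun C => (openGraph C).Reachable s y)
    (fun C C' h => Or.imp_right fun ⟨e, he, hze⟩ => ⟨e, h he, hze⟩)
    (fun C C' h hsy => hsy.mono (openGraph_mono h))
  have eA2 : {ω : BondConfig V | z ∈ ({s, y} : Set V) ∨ ∃ e ∈ ⋃ s' ∈ ({s, y} : Set V), openEdgeCluster ω s', z ∈ e} =
      openConn s z ∪ openConn y z := by
    rw [setOf_mem_or_exists_mem_biUnion_openEdgeCluster, biUnion_insert, biUnion_singleton]
  have eB2 : {ω : BondConfig V | (openGraph (⋃ s' ∈ ({s, y} : Set V), openEdgeCluster ω s')).Reachable s y} = openConn s y := by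
    ext ω
    simp only [mem_setOf_eq, mem]
    exact (reachable_iff_cluster ω ({s, y} : Set V) (mem_insert s {y}) y).symm
  simp only [eA2, eB2, ← hDE] at hHE
  -- hHE : μ(DE∩A∩Yᶜ) μ(DE∩Aᶜ∩Y) ≤ μ(DE∩A∩Y) μ(DE∩Aᶜ∩Yᶜ)
  ---------------------------------------------------------------- set identities with the tree cells
  have hsymm : ∀ (ω : BondConfig V) (u v : V), (openGraph ω).Reachable u v ↔ (openGraph ω).Reachable v u :=
    fun _ _ _ => ⟨fun h => h.symm, fun h => h.symm⟩
  -- (HE) cells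
  have e_c : DE ∩ (openConn s z ∪ openConn y z) ∩ openConn s y =
      {ω : BondConfig V | ∀ x ∈ X, ¬ (openGraph ω).Reachable s x} ∩ openConn s z ∩ openConn s y := by
    ext ω
    simp only [hDE, mem_inter_iff, mem_union, mem_setOf_eq, mem, forall_mem_insert, mem_singleton_iff, forall_eq]
    constructor
    · rintro ⟨⟨⟨hsX, hyX⟩, hz⟩, hsy⟩
      refine ⟨⟨hsX, ?_⟩, hsy⟩
      rcases hz with hsz | hyz
      · exact hsz
      · exact hsy.trans hyz
    · rintro ⟨⟨hsX, hsz⟩, hsy⟩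
      exact ⟨⟨⟨hsX, fun x hx hyx => hsX x hx (hsy.trans hyx)⟩, Or.inl hsz⟩, hsy⟩
  have e_b : DE ∩ (openConn s z ∪ openConn y z)ᶜ ∩ openConn s y =
      {ω : BondConfig V | ∀ x ∈ insert z X, ¬ (openGraph ω).Reachable s x} ∩ openConn s y := by
    ext ω
    simp only [hDE, mem_inter_iff, mem_compl_iff, mem_union, mem_setOf_eq, mem, forall_mem_insert, mem_singleton_iff,
      forall_eq, not_or]
    constructor
    · rintro ⟨⟨⟨hsX, _⟩, hsz, _⟩, hsy⟩
      exact ⟨⟨hsz, hsX⟩, hsy⟩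
    · rintro ⟨⟨hsz, hsX⟩, hsy⟩
      exact ⟨⟨⟨hsX, fun x hx hyx => hsX x hx (hsy.trans hyx)⟩, hsz, fun hyz => hsz (hsy.trans hyz)⟩, hsy⟩
  have e_aX : DE ∩ (openConn s z ∪ openConn y z)ᶜ ∩ (openConn s y)ᶜ =
      {ω : BondConfig V | ∀ x ∈ insert s (insert z X), ¬ (openGraph ω).Reachable y x} ∩
        {ω | ∀ x ∈ insert z X, ¬ (openGraph ω).Reachable s x} := by
    ext ω
    simp only [hDE, mem_inter_iff, mem_compl_iff, mem_union, mem_setOf_eq, mem, forall_mem_insert, mem_singleton_iff,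
      forall_eq, not_or]
    constructor
    · rintro ⟨⟨⟨hsX, hyX⟩, hsz, hyz⟩, hsy⟩
      exact ⟨⟨fun hys => hsy hys.symm, hyz, hyX⟩, hsz, hsX⟩
    · rintro ⟨⟨hys, hyz, hyX⟩, hsz, hsX⟩
      exact ⟨⟨⟨hsX, hyX⟩, hsz, hyz⟩, fun hsy => hys hsy.symm⟩
  -- the `u`-cell of (HE) splits along `Z = {s~z}` into `byE` (= the `u`-cell of (P)) and `b_X`
  have e_u := split_real w (DE ∩ (openConn s z ∪ openConn y z) ∩ (openConn s y)ᶜ) (openConn s z)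
  have e_u1 : DE ∩ (openConn s z ∪ openConn y z) ∩ (openConn s y)ᶜ ∩ openConn s z = D' ∩ openConn s z ∩ Bᶜ := by
    ext ω
    simp only [hDE, hD', hB, mem_inter_iff, mem_compl_iff, mem_union, mem_setOf_eq, mem, forall_mem_insert,
      mem_singleton_iff, forall_eq, not_exists, not_and]
    constructor
    · rintro ⟨⟨⟨⟨hsX, hyX⟩, _⟩, hsy⟩, hsz⟩
      exact ⟨⟨⟨hsy, hsX⟩, hsz⟩, hyX⟩
    · rintro ⟨⟨⟨hsy, hsX⟩, hsz⟩, hyX⟩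
      exact ⟨⟨⟨⟨hsX, hyX⟩, Or.inl hsz⟩, hsy⟩, hsz⟩
  have e_u2 : DE ∩ (openConn s z ∪ openConn y z) ∩ (openConn s y)ᶜ ∩ (openConn s z)ᶜ =
      {ω : BondConfig V | ∀ x ∈ insert s X, ¬ (openGraph ω).Reachable y x} ∩
        {ω | ∀ x ∈ X, ¬ (openGraph ω).Reachable s x} ∩ openConn y z := by
    ext ω
    simp only [hDE, mem_inter_iff, mem_compl_iff, mem_union, mem_setOf_eq, mem, forall_mem_insert, mem_singleton_iff,
      forall_eq]
    constructor
    · rintro ⟨⟨⟨⟨hsX, hyX⟩, hz⟩, hsy⟩, hsz⟩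
      refine ⟨⟨⟨fun hys => hsy hys.symm, hyX⟩, hsX⟩, ?_⟩
      rcases hz with hsz' | hyz
      · exact absurd hsz' hsz
      · exact hyz
    · rintro ⟨⟨⟨hys, hyX⟩, hsX⟩, hyz⟩
      exact ⟨⟨⟨⟨hsX, hyX⟩, Or.inr hyz⟩, fun hsy => hys hsy.symm⟩, fun hsz => hys (hyz.trans hsz.symm)⟩
  -- (P) cells against the tree cells
  have e_n : {ω : BondConfig V | (∀ x ∈ insert z X, ¬ (openGraph ω).Reachable s x) ∧ ¬ (openGraph ω).Reachable s y} =
      D' ∩ (openConn s z)ᶜ := by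
    ext ω
    simp only [hD', mem_inter_iff, mem_compl_iff, mem_setOf_eq, mem, forall_mem_insert, mem_singleton_iff, forall_eq]
    tauto
  have e_byp : {ω : BondConfig V | (∀ x ∈ X, ¬ (openGraph ω).Reachable s x) ∧ (openGraph ω).Reachable s z ∧
      ¬ (openGraph ω).Reachable s y} = D' ∩ openConn s z := by
    ext ω
    simp only [hD', mem_inter_iff, mem_setOf_eq, mem, forall_mem_insert, mem_singleton_iff, forall_eq]
    tauto
  have s_n := split_real w (D' ∩ (openConn s z)ᶜ) B
  have s_byp := split_real w (D' ∩ openConn s z) B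
  have s_t := split_real w (D' ∩ (openConn s z)ᶜ ∩ Bᶜ) (openConn y z)
  have e_t1 : D' ∩ (openConn s z)ᶜ ∩ Bᶜ ∩ openConn y z =
      {ω : BondConfig V | ∀ x ∈ insert s X, ¬ (openGraph ω).Reachable y x} ∩
        {ω | ∀ x ∈ X, ¬ (openGraph ω).Reachable s x} ∩ openConn y z := by
    ext ω
    simp only [hD', hB, mem_inter_iff, mem_compl_iff, mem_setOf_eq, mem, forall_mem_insert, mem_singleton_iff,
      forall_eq, not_exists, not_and]
    constructor
    · rintro ⟨⟨⟨⟨hsy, hsX⟩, _⟩, hyX⟩, hyz⟩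
      exact ⟨⟨⟨fun hys => hsy hys.symm, hyX⟩, hsX⟩, hyz⟩
    · rintro ⟨⟨⟨hys, hyX⟩, hsX⟩, hyz⟩
      exact ⟨⟨⟨⟨fun hsy => hys hsy.symm, hsX⟩, fun hsz => hys (hyz.trans hsz.symm)⟩, hyX⟩, hyz⟩
  have e_t2 : D' ∩ (openConn s z)ᶜ ∩ Bᶜ ∩ (openConn y z)ᶜ =
      {ω : BondConfig V | ∀ x ∈ insert s (insert z X), ¬ (openGraph ω).Reachable y x} ∩
        {ω | ∀ x ∈ insert z X, ¬ (openGraph ω).Reachable s x} := by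
    ext ω
    simp only [hD', hB, mem_inter_iff, mem_compl_iff, mem_setOf_eq, mem, forall_mem_insert, mem_singleton_iff,
      forall_eq, not_exists, not_and]
    constructor
    · rintro ⟨⟨⟨⟨hsy, hsX⟩, hsz⟩, hyX⟩, hyz⟩
      exact ⟨⟨fun hys => hsy hys.symm, hyz, hyX⟩, hsz, hsX⟩
    · rintro ⟨⟨hys, hyz, hyX⟩, hsz, hsX⟩
      exact ⟨⟨⟨⟨fun hsy => hys hsy.symm, hsX⟩, hsz⟩, hyX⟩, hyz⟩
  ---------------------------------------------------------------- assemble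
  rw [e_c, e_b, e_aX] at hHE
  rw [e_u1, e_u2] at e_u
  rw [e_t1, e_t2] at s_t
  rw [e_n] at hn
  rw [e_byp] at hbyp
  simp only [← haX, ← hbX, ← hc, ← hb] at hHE e_u s_t
  -- names for the remaining cells
  set byE := (prodBernoulli w).real (D' ∩ openConn s z ∩ Bᶜ) with hbyE
  set byr := (prodBernoulli w).real (D' ∩ openConn s z ∩ B) with hbyr
  set r := (prodBernoulli w).real (D' ∩ (openConn s z)ᶜ ∩ B) with hr
  set tt := (prodBernoulli w).real (D' ∩ (openConn s z)ᶜ ∩ Bᶜ) with htt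
  set uu := (prodBernoulli w).real (DE ∩ (openConn s z ∪ openConn y z) ∩ (openConn s y)ᶜ) with huu
  have hn' : nn = r + tt := hn.trans s_n
  have hbyp' : byp = byr + byE := hbyp.trans s_byp
  have hb0 : 0 ≤ b := measureReal_nonneg
  have hn0 : 0 ≤ nn := measureReal_nonneg
  have hbX0 : 0 ≤ bX := measureReal_nonneg
  have hbyp0 : 0 ≤ byp := measureReal_nonneg
  -- hHE : uu * b ≤ c * aX ; e_u : uu = byE + bX ; hP : byr * tt ≤ byE * r ; s_n : nn = r + tt ; s_byp : byp = byr + byE ; s_t : tt = bX + aX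
  have hHE' : 0 ≤ c * aX - b * (byE + bX) := by rw [← e_u]; linarith
  have hP' : 0 ≤ byE * r - byr * tt := by linarith
  -- identity: aX(c nn − b byp) − bX b nn = nn·(c aX − b(byE + bX)) + b·(byE r − byr tt) + b·bX·byp  (with nn = r + tt, tt = bX + aX, byp = byr + byE)
  have hid : aX * (c * nn - b * byp) - bX * b * nn =
      nn * (c * aX - b * (byE + bX)) + b * (byE * r - byr * tt) + b * bX * byp := by
    rw [hn', hbyp', s_t]; ring
  nlinarith [hid, mul_nonneg hn0 hHE', mul_nonneg hb0 hP']

/-- **THE REVERSE INEQUALITY AT GENERAL `X`** (hcond of `Consts.crossM2_of_ySplit` with the sides swapped):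
`b_X·b·n ≤ a_X·(c·n − b·b_y′)`. [cite: VandenbergHaggstromKahn2005, Thm. 2.1 (p. 10)] -/
theorem reverse_hcond_X (w : Sym2 V → unitInterval) (s y z : V) (X : Set V) :
    (prodBernoulli w).real ({ω : BondConfig V | ∀ x ∈ insert s X, ¬ (openGraph ω).Reachable y x} ∩
          {ω | ∀ x ∈ X, ¬ (openGraph ω).Reachable s x} ∩ openConn y z) *
        (prodBernoulli w).real ({ω : BondConfig V | ∀ x ∈ insert z X, ¬ (openGraph ω).Reachable s x} ∩ openConn s y) *
      (prodBernoulli w).real {ω : BondConfig V | (∀ x ∈ insert z X, ¬ (openGraph ω).Reachable s x) ∧ ¬ (openGraph ω).Reachable s y} ≤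
    (prodBernoulli w).real ({ω : BondConfig V | ∀ x ∈ insert s (insert z X), ¬ (openGraph ω).Reachable y x} ∩
          {ω | ∀ x ∈ insert z X, ¬ (openGraph ω).Reachable s x}) *
        ((prodBernoulli w).real ({ω : BondConfig V | ∀ x ∈ X, ¬ (openGraph ω).Reachable s x} ∩ openConn s z ∩ openConn s y) *
            (prodBernoulli w).real {ω : BondConfig V | (∀ x ∈ insert z X, ¬ (openGraph ω).Reachable s x) ∧ ¬ (openGraph ω).Reachable s y} -
          (prodBernoulli w).real ({ω : BondConfig V | ∀ x ∈ insert z X, ¬ (openGraph ω).Reachable s x} ∩ openConn s y) *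
            (prodBernoulli w).real {ω : BondConfig V | (∀ x ∈ X, ¬ (openGraph ω).Reachable s x) ∧ (openGraph ω).Reachable s z ∧
              ¬ (openGraph ω).Reachable s y}) := by
  have h := reverse_hcond_X_strong w s y z X
  have h0 : 0 ≤ (prodBernoulli w).real ({ω : BondConfig V | ∀ x ∈ insert z X, ¬ (openGraph ω).Reachable s x} ∩ openConn s y) *
        (prodBernoulli w).real ({ω : BondConfig V | ∀ x ∈ insert s X, ¬ (openGraph ω).Reachable y x} ∩
          {ω | ∀ x ∈ X, ¬ (openGraph ω).Reachable s x} ∩ openConn y z) *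
        (prodBernoulli w).real {ω : BondConfig V | (∀ x ∈ X, ¬ (openGraph ω).Reachable s x) ∧ (openGraph ω).Reachable s z ∧
              ¬ (openGraph ω).Reachable s y} :=
    mul_nonneg (mul_nonneg measureReal_nonneg measureReal_nonneg) measureReal_nonneg
  linarith

/-- **COROLLARY (the Y-split corollary class is degenerate at every `X`):** `hcond` of `Consts.crossM2_of_ySplit` forces
`b · b_X · b_y′ = 0` — i.e. on placements with `b = μ(s~y, s↮X∪{z}) > 0`: `b_X = 0` or `b_y′ = 0`. [cite: VandenbergHaggstromKahn2005, Thm. 2.1 (p. 10)] -/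
theorem hcond_imp_degenerate (w : Sym2 V → unitInterval) (s y z : V) (X : Set V)
    (hcond : (prodBernoulli w).real ({ω : BondConfig V | ∀ x ∈ insert s (insert z X), ¬ (openGraph ω).Reachable y x} ∩
          {ω | ∀ x ∈ insert z X, ¬ (openGraph ω).Reachable s x}) *
        ((prodBernoulli w).real ({ω : BondConfig V | ∀ x ∈ X, ¬ (openGraph ω).Reachable s x} ∩ openConn s z ∩ openConn s y) *
            (prodBernoulli w).real {ω : BondConfig V | (∀ x ∈ insert z X, ¬ (openGraph ω).Reachable s x) ∧ ¬ (openGraph ω).Reachable s y} -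
          (prodBernoulli w).real ({ω : BondConfig V | ∀ x ∈ insert z X, ¬ (openGraph ω).Reachable s x} ∩ openConn s y) *
            (prodBernoulli w).real {ω : BondConfig V | (∀ x ∈ X, ¬ (openGraph ω).Reachable s x) ∧ (openGraph ω).Reachable s z ∧
              ¬ (openGraph ω).Reachable s y}) ≤
      (prodBernoulli w).real ({ω : BondConfig V | ∀ x ∈ insert s X, ¬ (openGraph ω).Reachable y x} ∩
            {ω | ∀ x ∈ X, ¬ (openGraph ω).Reachable s x} ∩ openConn y z) *
          (prodBernoulli w).real ({ω : BondConfig V | ∀ x ∈ insert z X, ¬ (openGraph ω).Reachable s x} ∩ openConn s y) *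
        (prodBernoulli w).real {ω : BondConfig V | (∀ x ∈ insert z X, ¬ (openGraph ω).Reachable s x) ∧ ¬ (openGraph ω).Reachable s y}) :
    (prodBernoulli w).real ({ω : BondConfig V | ∀ x ∈ insert z X, ¬ (openGraph ω).Reachable s x} ∩ openConn s y) *
        (prodBernoulli w).real ({ω : BondConfig V | ∀ x ∈ insert s X, ¬ (openGraph ω).Reachable y x} ∩
          {ω | ∀ x ∈ X, ¬ (openGraph ω).Reachable s x} ∩ openConn y z) *
        (prodBernoulli w).real {ω : BondConfig V | (∀ x ∈ X, ¬ (openGraph ω).Reachable s x) ∧ (openGraph ω).Reachable s z ∧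
              ¬ (openGraph ω).Reachable s y} = 0 := by
  have h := reverse_hcond_X_strong w s y z X
  have h0 : 0 ≤ (prodBernoulli w).real ({ω : BondConfig V | ∀ x ∈ insert z X, ¬ (openGraph ω).Reachable s x} ∩ openConn s y) *
        (prodBernoulli w).real ({ω : BondConfig V | ∀ x ∈ insert s X, ¬ (openGraph ω).Reachable y x} ∩
          {ω | ∀ x ∈ X, ¬ (openGraph ω).Reachable s x} ∩ openConn y z) *
        (prodBernoulli w).real {ω : BondConfig V | (∀ x ∈ X, ¬ (openGraph ω).Reachable s x) ∧ (openGraph ω).Reachable s z ∧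
              ¬ (openGraph ω).Reachable s y} :=
    mul_nonneg (mul_nonneg measureReal_nonneg measureReal_nonneg) measureReal_nonneg
  linarith

end Consts.YSplitReverse

end Summit.CriticalPhenomena.PercolationContinuityZ3.Theorems

end
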